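import Literature.AnabelianGeometry.AbsoluteAnabelian.UnitKummerNaturalityCovariant
import HarnessLib

/-!
# [AbsTopIII] Prop 3.3 (i), model `TCG`-pairs: naturality of the unit Kummer maps with INTRINSIC
# coefficients `Λ((𝒪_k̄^×)ˣ)` — no `k̄ˣ`-extension datum

S. Mochizuki, *Topics in absolute anabelian geometry III*, §3, Prop. 3.3 (i) p. 73 (bib key
`MochizukiAbsTopIII2015`): for `T = TCG` the pair is `(Π_k ↷ 𝒪_k̄^×)` and the Kummer maps
`M^H → H¹(H, μ_Ẑ(M))` are functorial along the general morphisms `(φ_Π, φ_M)` of Def. 3.1 (ii) p. 67.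

abc-iut cell, layer L4, row «Prop33i-NATURALITY», piece «TCG-INTRINSIC» (abc-iut-L4-lead RULING #5p (1);
seat abc-iut-w4-d009 gen 4).  `UnitKummerNaturality(Covariant).lean` (p429455 / p429893) prove the `TCG` square
for morphisms whose unit map `φ_M : 𝒪_{k̄₁}^× → 𝒪_{k̄₂}^×` comes WITH an equivariant extension `Φ` to `k̄ˣ`,
because abc-iut-L4-t2's model `TCG` Kummer classes are taken with coefficients `Λ(k̄ˣ)`.  Here the square is
stated with the INTRINSIC coefficients `μ_Ẑ(M) = Λ((𝒪_k̄^×)ˣ)` of the `TCG`-object itself, along the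
equivariant morphism `(φ_Π, (φ_M)ˣ)` — NO auxiliary datum — and bridged to t2's classes along the inclusion
`(𝒪_k̄^×)ˣ ↪ k̄ˣ` (whose `Λ` is abc-iut-L4-t2's isomorphism `MLFClosure.cyclotomeUnitGroupEquiv`):

* two instances (the only non-theorem declarations): `Π_k ↷ (𝒪_k̄^×)ˣ` (Mathlib
  `Units.mulDistribMulActionRight` of t2's `unitSubmonoidAction`) and `RootableBy (𝒪_k̄^×)ˣ ℕ`
  (roots of units of `𝒪_k̄` taken in `k̄ˣ` are units of `𝒪_k̄`: integral by `IsIntegral.of_pow`, with integral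
  inverse `y^{n-1}·u⁻¹`);
* `GaloisMonoidPair.Hom.tcgIntrinsic_pullH1_kummerClass` — the Φ-free naturality square for ANY morphism of
  the model `TCG`-pairs, via abc-iut-L4-t2's `EquivariantMorphism.pullH1_kummerClass` BY NAME;
* `ModelMLFGaloisData.unitKummerTheoryTCG_kummer_eq_push_intrinsic` — t2's `TCG` Kummer class of `m ∈ 𝒪_k̄^×`
  in `H¹(H, Λ(k̄ˣ))` is the push-forward along `Λ((𝒪_k̄^×)ˣ ↪ k̄ˣ)` of the intrinsic class (comparison square).

HONEST FRAMING: OUR kernel statements about the model objects of a refereed 2015 paper (model-level record;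
the abstract-pair canonicity clause is abc-iut-L4-t2's O2); nothing here bears on [IUTchIII] Cor. 3.12.
-/

noncomputable section

open scoped ValuativeRel

universe u

namespace Literature.AnabelianGeometry.AbsoluteAnabelian

open Literature.AnabelianGeometry.EtaleTheta (EquivariantMorphism kummerClass invariants)

/-! ### The two instances -/

/-- `Π_k ↷ (𝒪_k̄^×)ˣ`: the action of `Π_k` on the unit group of the monoid `𝒪_k̄^×` induced by t2's
`unitSubmonoidAction` (Mathlib `Units.mulDistribMulActionRight`; `(g • u : k̄) = ε_k(g)(u)`).
[cite: MochizukiAbsTopIII2015, Definition 3.1 (i) p.67] -/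
instance ModelMLFGaloisData.unitSubmonoidUnitsAction {k : Type u} [Field k] [ValuativeRel k] {K : Type u}
    [Field K] [Algebra k K] (D : ModelMLFGaloisData k K) : MulDistribMulAction D.Pi (unitSubmonoid k K)ˣ :=
  Units.mulDistribMulActionRight

/-- An `n`-th root in `k̄ˣ` (`n ≥ 1`) of a unit `u` of `𝒪_k̄^×` lies in `𝒪_k̄^×`: it is integral over `𝒪_k` since
`y^n = u` is (Mathlib `IsIntegral.of_pow`), with integral inverse `y^{n-1} · u⁻¹`.
[cite: MochizukiAbsTopIII2015, Definition 3.1 (i) p.66] -/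
theorem MLFClosure.coe_root_unitsMap_mem_unitSubmonoid (C : MLFClosure.{u}) (u : (unitSubmonoid C.k C.K)ˣ)
    {n : ℕ} (hn : n ≠ 0) :
    ((RootableBy.root (Units.map (unitSubmonoid C.k C.K).subtype u) n : (C.K)ˣ) : C.K) ∈
      unitSubmonoid C.k C.K := by
  set y : (C.K)ˣ := RootableBy.root (Units.map (unitSubmonoid C.k C.K).subtype u) n with hy
  have hyn : (y : C.K) ^ n = (((u : (unitSubmonoid C.k C.K)ˣ) : unitSubmonoid C.k C.K) : C.K) := by
    have h := congrArg (fun v : (C.K)ˣ => (v : C.K))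
      (RootableBy.root_cancel (Units.map (unitSubmonoid C.k C.K).subtype u) hn)
    simpa [hy, Units.val_pow_eq_pow_val] using h
  have hu : (((u : (unitSubmonoid C.k C.K)ˣ) : unitSubmonoid C.k C.K) : C.K) ∈ integersClosure C.k C.K :=
    ((u : (unitSubmonoid C.k C.K)ˣ) : unitSubmonoid C.k C.K).2.1
  have hu' : (((u⁻¹ : (unitSubmonoid C.k C.K)ˣ) : unitSubmonoid C.k C.K) : C.K) ∈ integersClosure C.k C.K :=
    ((u⁻¹ : (unitSubmonoid C.k C.K)ˣ) : unitSubmonoid C.k C.K).2.1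
  have huu' : (((u : (unitSubmonoid C.k C.K)ˣ) : unitSubmonoid C.k C.K) : C.K) *
      (((u⁻¹ : (unitSubmonoid C.k C.K)ˣ) : unitSubmonoid C.k C.K) : C.K) = 1 := by
    rw [← Submonoid.coe_mul, ← Units.val_mul, mul_inv_cancel, Units.val_one, Submonoid.coe_one]
  have hyint : (y : C.K) ∈ integersClosure C.k C.K := by
    have h : IsIntegral 𝒪[C.k] ((y : C.K) ^ n) := by rw [hyn]; exact hu
    exact h.of_pow (Nat.pos_of_ne_zero hn)
  refine ⟨hyint, (y : C.K) ^ (n - 1) * (((u⁻¹ : (unitSubmonoid C.k C.K)ˣ) : unitSubmonoid C.k C.K) : C.K),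
    Subalgebra.mul_mem _ (Subalgebra.pow_mem _ hyint _) hu', ?_⟩
  rw [← mul_assoc, ← pow_succ', Nat.sub_add_cancel (Nat.pos_of_ne_zero hn), hyn, huu']

/-- The inverse of such a root also lies in `𝒪_k̄^×`. [cite: MochizukiAbsTopIII2015, Definition 3.1 (i) p.66] -/
theorem MLFClosure.coe_root_unitsMap_inv_mem_unitSubmonoid (C : MLFClosure.{u}) (u : (unitSubmonoid C.k C.K)ˣ)
    {n : ℕ} (hn : n ≠ 0) :
    (((RootableBy.root (Units.map (unitSubmonoid C.k C.K).subtype u) n)⁻¹ : (C.K)ˣ) : C.K) ∈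
      unitSubmonoid C.k C.K := by
  obtain ⟨hy, w, hw, hyw⟩ := C.coe_root_unitsMap_mem_unitSubmonoid u hn
  have hw' : (((RootableBy.root (Units.map (unitSubmonoid C.k C.K).subtype u) n)⁻¹ : (C.K)ˣ) : C.K) = w := by
    rw [Units.val_inv_eq_inv_val]
    exact inv_eq_of_mul_eq_one_right hyw
  rw [hw']
  exact ⟨hw, _, hy, by rw [mul_comm]; exact hyw⟩

/-- **`(𝒪_k̄^×)ˣ` is rootable**: the `n`-th root of a unit `u` of `𝒪_k̄^×` taken in `k̄ˣ` (t2's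
`MLFClosure.rootableByUnits`) is again a unit of `𝒪_k̄^×` (`coe_root_unitsMap_mem_unitSubmonoid`).
[cite: MochizukiAbsTopIII2015, Definition 3.1 (i) p.66] -/
instance MLFClosure.rootableByUnitSubmonoidUnits (C : MLFClosure.{u}) :
    RootableBy (unitSubmonoid C.k C.K)ˣ ℕ where
  root u n :=
    if hn : n = 0 then 1 else
      ⟨⟨(RootableBy.root (Units.map (unitSubmonoid C.k C.K).subtype u) n : (C.K)ˣ),
          C.coe_root_unitsMap_mem_unitSubmonoid u hn⟩,
        ⟨(((RootableBy.root (Units.map (unitSubmonoid C.k C.K).subtype u) n)⁻¹ : (C.K)ˣ) : C.K),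
          C.coe_root_unitsMap_inv_mem_unitSubmonoid u hn⟩,
        Subtype.ext (Units.mul_inv _), Subtype.ext (Units.inv_mul _)⟩
  root_zero u := dif_pos rfl
  root_cancel {n} u hn := by
    rw [dif_neg hn]
    refine Units.ext (Subtype.ext ?_)
    have h := congrArg (fun v : (C.K)ˣ => (v : C.K))
      (RootableBy.root_cancel (Units.map (unitSubmonoid C.k C.K).subtype u) hn)
    simpa [Units.val_pow_eq_pow_val] using h

/-! ### The Φ-free naturality square for model `TCG`-pairs -/

namespace GaloisMonoidPair.Hom

variable {C₁ C₂ : MLFClosure.{0}} {D₁ : ModelMLFGaloisData C₁.k C₁.K} {D₂ : ModelMLFGaloisData C₂.k C₂.K}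

/-- `(φ_M)ˣ : (𝒪_{k̄₁}^×)ˣ → (𝒪_{k̄₂}^×)ˣ` is `φ_Π`-equivariant (Def. 3.1 (ii) "compatible").
[cite: MochizukiAbsTopIII2015, Definition 3.1 (ii) p.67] -/
theorem unitsMap_homM_smul (φ : GaloisMonoidPair.Hom D₁.tcgPair D₂.tcgPair) (g : D₁.Pi)
    (u : (unitSubmonoid C₁.k C₁.K)ˣ) : Units.map φ.homM (g • u) = φ.homPi g • Units.map φ.homM u :=
  Units.ext (φ.smul_comm g (u : unitSubmonoid C₁.k C₁.K))

/-- **Prop 3.3 (i) functoriality, model `TCG`-pairs, INTRINSIC coefficients, no auxiliary datum.**  For ANY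
morphism `φ = (φ_Π, φ_M) : (Π_{k₁} ↷ 𝒪_{k̄₁}^×) → (Π_{k₂} ↷ 𝒪_{k̄₂}^×)` of the model `TCG`-pairs (Def. 3.1 (ii); `φ_Π`
NOT assumed invertible), open `H₁`, `H₂` with `φ_Π(H₁) ≤ H₂`, and invariant units `u₁ ∈ ((𝒪_{k̄₁}^×)ˣ)^{H₁}`,
`u₂ ∈ ((𝒪_{k̄₂}^×)ˣ)^{H₂}` with `(φ_M)ˣ u₁ = u₂`:
`φ_Π^* (κ_{H₂} u₂) = Λ((φ_M)ˣ)_* (κ_{H₁} u₁)` in `H¹(H₁, res_{φ_Π} Λ((𝒪_{k̄₂}^×)ˣ))`, the `κ` being the Kummer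
classes with the intrinsic coefficients `μ_Ẑ(𝒪_k̄^×) = Λ((𝒪_k̄^×)ˣ)` (abc-iut-L4-t2's
`EquivariantMorphism.pullH1_kummerClass` BY NAME). [cite: MochizukiAbsTopIII2015, Proposition 3.3 (i) p.73] -/
theorem tcgIntrinsic_pullH1_kummerClass (φ : GaloisMonoidPair.Hom D₁.tcgPair D₂.tcgPair)
    {H₁ : OpenSubgroup D₁.tcgPair.Pi} {H₂ : OpenSubgroup D₂.tcgPair.Pi}
    (hH : (H₁ : Subgroup D₁.Pi).map φ.homPi ≤ (H₂ : Subgroup D₂.Pi))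
    (u₁ : invariants (A := (unitSubmonoid C₁.k C₁.K)ˣ) (H₁ : Subgroup D₁.Pi))
    (u₂ : invariants (A := (unitSubmonoid C₂.k C₂.K)ˣ) (H₂ : Subgroup D₂.Pi))
    (h : Units.map φ.homM (u₁ : (unitSubmonoid C₁.k C₁.K)ˣ) = u₂) :
    (⟨φ.homPi, Units.map φ.homM, φ.unitsMap_homM_smul⟩ :
        EquivariantMorphism D₁.Pi (unitSubmonoid C₁.k C₁.K)ˣ D₂.Pi (unitSubmonoid C₂.k C₂.K)ˣ).pullH1 hH
        (kummerClass (H₂ : Subgroup D₂.Pi) u₂) =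
      (⟨φ.homPi, Units.map φ.homM, φ.unitsMap_homM_smul⟩ :
        EquivariantMorphism D₁.Pi (unitSubmonoid C₁.k C₁.K)ˣ D₂.Pi (unitSubmonoid C₂.k C₂.K)ˣ).pushH1 hH
        (kummerClass (H₁ : Subgroup D₁.Pi) u₁) :=
  EquivariantMorphism.pullH1_kummerClass _ hH u₁ u₂ h

end GaloisMonoidPair.Hom

/-! ### Comparison with t2's `TCG` Kummer classes in `H¹(H, Λ(k̄ˣ))` -/

namespace ModelMLFGaloisData

variable (C : MLFClosure.{0}) (D : ModelMLFGaloisData C.k C.K)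

/-- The inclusion `(𝒪_k̄^×)ˣ ↪ k̄ˣ` is `Π_k`-equivariant. [cite: MochizukiAbsTopIII2015, Definition 3.1 (i) p.67] -/
theorem unitsMap_subtype_smul (g : D.Pi) (u : (unitSubmonoid C.k C.K)ˣ) :
    Units.map (unitSubmonoid C.k C.K).subtype (g • u) = g • Units.map (unitSubmonoid C.k C.K).subtype u :=
  Units.ext rfl

/-- **Comparison square.**  For open `H ≤ Π_k` and an `H`-invariant unit `u` of `𝒪_k̄^×`, t2's `TCG` Kummer class
of `u` (`unitKummerTheoryTCG`, coefficients `Λ(k̄ˣ)`) and the intrinsic Kummer class of `u` (coefficients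
`Λ((𝒪_k̄^×)ˣ)`) agree in `H¹(H, Λ(k̄ˣ))`: pulled back along `id_H`, the former is the push-forward of the latter
along `Λ((𝒪_k̄^×)ˣ ↪ k̄ˣ)` (= t2's isomorphism `MLFClosure.cyclotomeUnitGroupEquiv` on coefficients).
[cite: MochizukiAbsTopIII2015, Proposition 3.3 (i) p.73] -/
theorem unitKummerTheoryTCG_kummer_eq_push_intrinsic (H : OpenSubgroup D.tcgPair.Pi)
    (u : invariants (A := (unitSubmonoid C.k C.K)ˣ) (H : Subgroup D.Pi)) :
    (⟨MonoidHom.id D.Pi, Units.map (unitSubmonoid C.k C.K).subtype, D.unitsMap_subtype_smul C⟩ :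
        EquivariantMorphism D.Pi (unitSubmonoid C.k C.K)ˣ D.Pi (C.K)ˣ).pullH1 (Subgroup.map_id _).le
        ((D.unitKummerTheoryTCG C).kummer H
          ⟨((u : (unitSubmonoid C.k C.K)ˣ) : unitSubmonoid C.k C.K),
            fun h => congrArg Units.val (u.2 ⟨h.1, h.2⟩)⟩) =
      (⟨MonoidHom.id D.Pi, Units.map (unitSubmonoid C.k C.K).subtype, D.unitsMap_subtype_smul C⟩ :
        EquivariantMorphism D.Pi (unitSubmonoid C.k C.K)ˣ D.Pi (C.K)ˣ).pushH1 (Subgroup.map_id _).le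
        (kummerClass (H : Subgroup D.Pi) u) := by
  rw [unitKummerTheoryTCG_kummer]
  exact EquivariantMorphism.pullH1_kummerClass _ _ u _ (Units.ext rfl)

end ModelMLFGaloisData

end Literature.AnabelianGeometry.AbsoluteAnabelian

end
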